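import Literature.Probability.RandomGraphs.PlantedCliqueLowDegree
import HarnessLib

/-!
# The binomial random graph `G(n, p)` (Erdős–Rényi–Gilbert model)

Definition (real, with body; NO named facts in this file) of the law of the binomial random graph
`G(n, p)` on the vertex set `Fin n`: each of the `C(n,2)` pairs `{i, j}`, `i < j`, is an edge
independently with probability `p` (clamped to `[0, 1]` as `min 1 (ENNReal.ofReal p)`), in the
words of Rödl–Ruciński (JAMS 1995, p. 919, the "binomial model" `K(n, p)`): "For every 2-element
subset of `[n]`, make it an edge of `K(n, p)` with probability `p = p(n)`, where all `C(n,2)`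
decisions are mutually independent."

* `erdosRenyi n p : PMF (SimpleGraph (Fin n))` — realised EXACTLY as route PneNP/RamseyThreshold
  inlines it (seven statement items): the product-Bernoulli bit vector
  `bernoulliVec (n * n) (min 1 (ENNReal.ofReal p))` of `PlantedCliqueLowDegree.lean` (one bit per
  ORDERED pair `(i, j)`, index `finProdFinEquiv (i, j) : Fin (n * n)`), pushed forward along
  `s ↦ SimpleGraph.fromRel (fun i j ↦ i < j ∧ s (finProdFinEquiv (i, j)) = true)` — only the
  bits of pairs with `i < j` are read; the other `n(n+1)/2` bits are integrated out. Hence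
  `erdosRenyi_eq` (the route's expression, by `rfl`), so those items can be restated by rewriting.
* `edgeProb p = min 1 (ENNReal.ofReal p)` — the clamped edge probability (`= p` for `0 ≤ p ≤ 1`,
  `0` for `p ≤ 0`, `1` for `p ≥ 1`).
* PROVED marginals: `bernoulliVec_toOuterMeasure_apply_eq_true` (a single coordinate of the
  product-Bernoulli vector is `true` with probability `q`) and
  **`erdosRenyi_toOuterMeasure_adj`**: `Pr[ {i, j} ∈ E(G(n,p)) ] = edgeProb p` for `i ≠ j`;
  `erdosRenyi_adj_iff` (which bit decides adjacency).

## Design notes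

* Values of `p` outside `[0, 1]` are clamped, never rejected: `G(n, p) = G(n, 0)` (empty graph
  a.s.) for `p ≤ 0` and `= G(n, 1)` (complete graph a.s.) for `p ≥ 1`; threshold statements read
  `p = p(n)` at face value.
* Cone note: this file imports `PlantedCliqueLowDegree.lean` for `bernoulliVec`, exactly as the
  route file already does; it adds no named fact of its own.
* Not here (asked for by the definition request, left for follow-ups): the bridge to
  `erdosRenyiHalf n : PMF (EdgeVec n)` of `PlantedClique.lean` at `p = 1/2` (different sample
  space: edge vectors of `K_n` rather than `SimpleGraph (Fin n)`), joint independence of the edge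
  indicators as a `iIndepFun` statement, and the monotone coupling in `p`.

## References

* V. Rödl, A. Ruciński, *Threshold functions for Ramsey properties*, J. Amer. Math. Soc. 8 (1995)
  917–942, p. 919 (the binomial model `K(n, p)`). [RodlRucinski1995]
* B. Bollobás, *Random Graphs*, 2nd ed., CUP 2001, §2.1 (the spaces `𝒢(n, p)`, `𝒢(n, M)`).
  [folklore pointer; not cited in tags]
-/

noncomputable section

namespace Literature.Probability.RandomGraphs

open PlantedClique Finset

/-! ### One coordinate of a product-Bernoulli vector -/

/-- **Marginal of the product-Bernoulli vector**: under `bernoulliVec m q` a fixed coordinate `e`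
equals `true` with probability `q`. [folklore] -/
theorem bernoulliVec_toOuterMeasure_apply_eq_true (m : ℕ) (q : ENNReal) (hq : q ≤ 1) (e : Fin m) :
    (bernoulliVec m q hq).toOuterMeasure {s | s e = true} = q := by
  classical
  rw [PMF.toOuterMeasure_apply_fintype]
  -- restrict the weight of coordinate `e` to the value `true`
  set w : Fin m → Bool → ENNReal := fun i b ↦ bernWeight q b * (if i = e then (if b then 1 else 0) else 1)
    with hw
  have hterm : ∀ s : Fin m → Bool,
      Set.indicator {s : Fin m → Bool | s e = true} (bernoulliVec m q hq) s = ∏ i, w i (s i) := by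
    intro s
    by_cases hs : s e = true
    · rw [Set.indicator_of_mem (by exact hs), bernoulliVec_apply]
      refine Finset.prod_congr rfl fun i _ ↦ ?_
      by_cases hi : i = e
      · subst hi; simp [hw, hs]
      · simp [hw, hi]
    · rw [Set.indicator_of_notMem (by exact hs)]
      symm
      apply Finset.prod_eq_zero (Finset.mem_univ e)
      simp [hw, hs]
  simp_rw [hterm]
  rw [← Fintype.piFinset_univ, ← Finset.prod_univ_sum]
  have hsum : ∀ i, ∑ b ∈ (univ : Finset Bool), w i b = if i = e then q else 1 := by
    intro i
    by_cases hi : i = e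
    · subst hi; simp [hw, bernWeight]
    · simp [hw, hi, bernWeight, add_tsub_cancel_of_le hq]
  simp_rw [hsum]
  rw [Finset.prod_ite_eq' univ e fun _ ↦ q]
  simp

/-! ### The model -/

/-- The clamped edge probability `min 1 (ENNReal.ofReal p) ∈ [0, 1]` of `G(n, p)`. [folklore] -/
def edgeProb (p : ℝ) : ENNReal := min 1 (ENNReal.ofReal p)

/-- `edgeProb p ≤ 1`. [folklore] -/
theorem edgeProb_le_one (p : ℝ) : edgeProb p ≤ 1 := min_le_left _ _

/-- For `0 ≤ p ≤ 1` the clamp is inactive: `edgeProb p = ENNReal.ofReal p`. [folklore] -/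
theorem edgeProb_eq {p : ℝ} (hp : p ≤ 1) : edgeProb p = ENNReal.ofReal p :=
  min_eq_right (ENNReal.ofReal_le_one.2 hp)

/-- For `p ≤ 0`, `edgeProb p = 0` (`G(n, p)` is a.s. empty). [folklore] -/
theorem edgeProb_of_nonpos {p : ℝ} (hp : p ≤ 0) : edgeProb p = 0 := by
  rw [edgeProb, ENNReal.ofReal_of_nonpos hp]
  simp

/-- For `1 ≤ p`, `edgeProb p = 1` (`G(n, p)` is a.s. complete). [folklore] -/
theorem edgeProb_of_one_le {p : ℝ} (hp : 1 ≤ p) : edgeProb p = 1 :=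
  min_eq_left (ENNReal.one_le_ofReal.2 hp)

/-- **The binomial random graph `G(n, p)`** (Erdős–Rényi–Gilbert; Rödl–Ruciński's binomial model
`K(n, p)`, JAMS 1995 p. 919: "For every 2-element subset of `[n]`, make it an edge of `K(n,p)` with
probability `p`, where all `C(n,2)` decisions are mutually independent"), as a probability mass
function on `SimpleGraph (Fin n)`: a product-Bernoulli bit vector indexed by ordered pairs
(`bernoulliVec (n * n) (min 1 (ENNReal.ofReal p))`, bit of `(i, j)` at `finProdFinEquiv (i, j)`)
pushed forward along `s ↦ fromRel (i < j ∧ s (i, j))`, so that `{i, j}`, `i < j`, is an edge iff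
the bit of `(i, j)` is set; `p` is clamped to `[0, 1]`. This is literally the expression inlined in
route PneNP/RamseyThreshold (`erdosRenyi_eq`). [cite: RodlRucinski1995, §1 p. 919 (binomial model)] -/
def erdosRenyi (n : ℕ) (p : ℝ) : PMF (SimpleGraph (Fin n)) :=
  ((bernoulliVec (n * n) (min 1 (ENNReal.ofReal p))) (min_le_left _ _)).map
    (fun s => SimpleGraph.fromRel fun i j : Fin n => i < j ∧ s (finProdFinEquiv (i, j)) = true)

/-- `erdosRenyi n p` IS the expression inlined in route PneNP/RamseyThreshold (items
`RandomRamseyHypothesis`, `SosBlindAboveThreshold`, `QuietNonArrowingPlanting`,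
`TriangleArrowingSosEasy`, `RodlRucinskiK4`, `RandomRamseyCertifier`), definitionally. [folklore] -/
theorem erdosRenyi_eq (n : ℕ) (p : ℝ) :
    erdosRenyi n p =
      ((bernoulliVec (n * n) (min 1 (ENNReal.ofReal p))) (min_le_left _ _)).map
        (fun s => SimpleGraph.fromRel fun i j : Fin n => i < j ∧ s (finProdFinEquiv (i, j)) = true) :=
  rfl

/-- The same with the clamped probability named: `erdosRenyi n p = (bernoulliVec (n*n) (edgeProb p) _).map _`.
[folklore] -/
theorem erdosRenyi_eq_map_edgeProb (n : ℕ) (p : ℝ) :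
    erdosRenyi n p =
      ((bernoulliVec (n * n) (edgeProb p)) (edgeProb_le_one p)).map
        (fun s => SimpleGraph.fromRel fun i j : Fin n => i < j ∧ s (finProdFinEquiv (i, j)) = true) :=
  rfl

/-- **Which bit decides adjacency.** In the sample `fromRel (i < j ∧ s (i, j))`, two distinct
vertices `i ≠ j` are adjacent iff the bit of the increasing ordering of the pair is set.
[folklore] -/
theorem fromRel_lt_adj_iff {n : ℕ} (s : Fin (n * n) → Bool) {i j : Fin n} (hij : i < j) :
    (SimpleGraph.fromRel fun a b : Fin n => a < b ∧ s (finProdFinEquiv (a, b)) = true).Adj i j ↔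
      s (finProdFinEquiv (i, j)) = true := by
  rw [SimpleGraph.fromRel_adj]
  constructor
  · rintro ⟨-, ⟨-, h⟩ | ⟨hji, -⟩⟩
    · exact h
    · exact absurd hij (lt_asymm hji)
  · exact fun h ↦ ⟨hij.ne, Or.inl ⟨hij, h⟩⟩

/-- **Edge marginals of `G(n, p)`**: for `i < j`, `Pr[ G.Adj i j ] = edgeProb p = min 1 p`.
[cite: RodlRucinski1995, §1 p. 919 (binomial model)] -/
theorem erdosRenyi_toOuterMeasure_adj {n : ℕ} (p : ℝ) {i j : Fin n} (hij : i < j) :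
    (erdosRenyi n p).toOuterMeasure {G | G.Adj i j} = edgeProb p := by
  rw [erdosRenyi_eq_map_edgeProb, PMF.toOuterMeasure_map_apply]
  have hset : (fun s : Fin (n * n) → Bool =>
      SimpleGraph.fromRel fun a b : Fin n => a < b ∧ s (finProdFinEquiv (a, b)) = true) ⁻¹'
        {G : SimpleGraph (Fin n) | G.Adj i j} = {s | s (finProdFinEquiv (i, j)) = true} := by
    ext s
    exact fromRel_lt_adj_iff s hij
  rw [hset]
  exact bernoulliVec_toOuterMeasure_apply_eq_true _ _ _ _

/-- Edge marginals for an arbitrary pair of distinct vertices (symmetry of `Adj`): for `i ≠ j`,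
`Pr[ G.Adj i j ] = edgeProb p`. [cite: RodlRucinski1995, §1 p. 919 (binomial model)] -/
theorem erdosRenyi_toOuterMeasure_adj_of_ne {n : ℕ} (p : ℝ) {i j : Fin n} (hij : i ≠ j) :
    (erdosRenyi n p).toOuterMeasure {G | G.Adj i j} = edgeProb p := by
  rcases lt_or_gt_of_ne hij with h | h
  · exact erdosRenyi_toOuterMeasure_adj p h
  · have : {G : SimpleGraph (Fin n) | G.Adj i j} = {G | G.Adj j i} := by
      ext G; exact ⟨fun h ↦ h.symm, fun h ↦ h.symm⟩
    rw [this]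
    exact erdosRenyi_toOuterMeasure_adj p h

/-- For `0 ≤ p ≤ 1` the edge marginal is `p` itself. [folklore] -/
theorem erdosRenyi_toOuterMeasure_adj_eq_ofReal {n : ℕ} {p : ℝ} (hp : p ≤ 1) {i j : Fin n}
    (hij : i ≠ j) : (erdosRenyi n p).toOuterMeasure {G | G.Adj i j} = ENNReal.ofReal p := by
  rw [erdosRenyi_toOuterMeasure_adj_of_ne p hij, edgeProb_eq hp]

end Literature.Probability.RandomGraphs
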